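import Literature.NumberTheory.QuadraticFields.InfrastructureMinima
import HarnessLib

/-!
# Units on the principal cycle: the walk by reduction steps reaches the next unit and skips none

Topic `NumberTheory/QuadraticFields` (the infrastructure of a real quadratic order, IV), continuing
`InfrastructureMinima.lean` (frames `St = (a, b, p, r)`, `Inv`, `Red`, the step `bstep = ρ`, minima).
Following Jacobson–Williams, *Solving the Pell Equation*, §5.3 and §7.4:

* `Nm`, `IsUnitO` — the norm form `x² + σxy - c_ω y²` of `𝒪_Δ` and its units; a unit is a minimum
  (`IsUnitO.isMin`), and in a frame `θ` is a unit iff the ideal is `𝒪` itself, i.e. `a = 1`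
  (`Inv.a_eq_one_of_isUnitO`, `Inv.isUnitO_of_a_eq_one`; op. cit. §7.4: "`𝔞_1 = (1)` is at distance
  `0` and at distance `R_Δ`");
* `walk n = ρⁿ` — iterating the step keeps frames reduced, `|θ|` increases strictly, more than
  doubles every two steps and grows by less than a factor `√Δ` per step (op. cit. (5.9), proof of
  Thm. 5.18, Cor. 5.8.1);
* `exists_hit` — **the walk reaches every minimum beyond `θ₀` exactly** (op. cit. Thm. 5.18: every
  reduced ideal equivalent to `𝔞` is some `ρⁿ(𝔞)`), within `2k` steps once `2ᵏ|θ₀| ≥ |μ|`;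
* `first_unit` — the first `n ≥ 1` with `a_n = 1` is the step at which `|θ_n|` equals the least unit
  beyond `|θ₀|` (op. cit. §7.4, computing `R_Δ` by walking the principal cycle back to `(1)`).

Everything is proved; no named facts.

## References

* M. J. Jacobson, Jr., H. C. Williams, *Solving the Pell Equation*, CMS Books in Mathematics, Springer
  (2009), §4.1 (norm), §5.1 Cor. 5.8.1, §5.3 Thm. 5.18, §7.4. [JacobsonWilliams2008]
-/

noncomputable section

open scoped Classical

namespace Literature.NumberTheory.QuadraticFields.Infra

variable {Δ : ℕ}

/-! ### Norms and units -/

/-- The norm form of `𝒪_Δ` in coordinates: `N(x + yω) = x² + σxy - c_ω y²`. [cite: JacobsonWilliams2008, §4.1 (norm)] -/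
def Nm (Δ : ℕ) (p : ℤ × ℤ) : ℤ := p.1 ^ 2 + sig Δ * p.1 * p.2 - cw Δ * p.2 ^ 2

/-- `θ θ̄ = N(θ)`. [cite: JacobsonWilliams2008, §4.1 (norm)] -/
theorem ev_mul_ev_neg (hΔ : IsDisc Δ) (p : ℤ × ℤ) : ev Δ (rt Δ) p * ev Δ (-rt Δ) p = Nm Δ p := by
  have h4 : (4 : ℝ) * cw Δ = Δ - sig Δ := by exact_mod_cast four_mul_cw hΔ
  have hs : (sig Δ : ℝ) * sig Δ = sig Δ := by exact_mod_cast sig_sq Δ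
  have ht := rt_sq Δ
  unfold ev Nm; push_cast
  linear_combination ((p.2 : ℝ) ^ 2 / 4) * hs - ((p.2 : ℝ) ^ 2 / 4) * ht + ((p.2 : ℝ) ^ 2 / 4) * h4

/-- `omul` is commutative. [folklore] -/
theorem omul_comm (Δ : ℕ) (p q : ℤ × ℤ) : omul Δ p q = omul Δ q p := by
  unfold omul; ext <;> simp only <;> ring

/-- `ev t (1, 0) = 1`. [folklore] -/
@[simp] theorem ev_one (Δ : ℕ) (t : ℝ) : ev Δ t (1, 0) = 1 := by unfold ev; simp

/-- `ev t (-p) = -ev t p` in the form `ev t (lin (-1) 0 p p)`. [folklore] -/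
theorem ev_neg (Δ : ℕ) (t : ℝ) (p : ℤ × ℤ) : ev Δ t (-p.1, -p.2) = -ev Δ t p := by
  unfold ev; push_cast; ring

/-- **Units of `𝒪_Δ`** in coordinates: `p` is invertible in `𝒪`. [cite: JacobsonWilliams2008, §4.1 (units)] -/
def IsUnitO (Δ : ℕ) (p : ℤ × ℤ) : Prop := ∃ q : ℤ × ℤ, omul Δ p q = (1, 0)

/-- A unit and its inverse evaluate to reciprocal reals under both embeddings. [cite: JacobsonWilliams2008, §4.1] -/
theorem IsUnitO.exists_inv (hΔ : IsDisc Δ) {p : ℤ × ℤ} (h : IsUnitO Δ p) :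
    ∃ q : ℤ × ℤ, ev Δ (rt Δ) p * ev Δ (rt Δ) q = 1 ∧ ev Δ (-rt Δ) p * ev Δ (-rt Δ) q = 1 := by
  obtain ⟨q, hq⟩ := h
  refine ⟨q, ?_, ?_⟩
  · rw [← ev_omul hΔ (rt_sq Δ), hq, ev_one]
  · rw [← ev_omul hΔ (neg_rt_sq Δ), hq, ev_one]

/-- A unit has `|N| = 1`, in the real form `|θ| · |θ̄| = 1`. [cite: JacobsonWilliams2008, §4.1 (units)] -/
theorem IsUnitO.abs_mul_abs (hΔ : IsDisc Δ) {p : ℤ × ℤ} (h : IsUnitO Δ p) :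
    |ev Δ (rt Δ) p| * |ev Δ (-rt Δ) p| = 1 := by
  obtain ⟨q, h1, h2⟩ := h.exists_inv hΔ
  have hN : (Nm Δ p : ℝ) * Nm Δ q = 1 := by
    rw [← ev_mul_ev_neg hΔ, ← ev_mul_ev_neg hΔ]
    linear_combination (ev Δ (-rt Δ) p * ev Δ (-rt Δ) q) * h1 + h2
  have hN' : Nm Δ p * Nm Δ q = 1 := by exact_mod_cast hN
  have habs : |(Nm Δ p : ℝ)| = 1 := by
    rcases Int.eq_one_or_neg_one_of_mul_eq_one hN' with h | h <;> simp [h]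
  rw [← abs_mul, ev_mul_ev_neg hΔ, habs]

/-- The norm of a nonzero element is a nonzero integer. [cite: JacobsonWilliams2008, §4.1] -/
theorem Nm_ne_zero (hΔ : IsDisc Δ) {q : ℤ × ℤ} (hq : q ≠ (0, 0)) : Nm Δ q ≠ 0 := by
  intro h0
  have h : ev Δ (rt Δ) q * ev Δ (-rt Δ) q = 0 := by rw [ev_mul_ev_neg hΔ, h0]; simp
  rcases mul_eq_zero.mp h with h | h
  · exact hq (eq_zero_of_ev_eq_zero (irrational_rt hΔ) h)
  · exact hq (eq_zero_of_ev_eq_zero (irrational_neg_rt hΔ) h)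

/-- **A unit is a minimum of `𝒪`**: a nonzero `β` with `|β| < |ε|` and `|β̄| < |ε̄|` would have
`|N(β)| < 1`. [cite: JacobsonWilliams2008, §5.3 (units on the principal cycle)] -/
theorem IsUnitO.isMin (hΔ : IsDisc Δ) {p : ℤ × ℤ} (h : IsUnitO Δ p) : IsMin Δ p := by
  have h1 := h.abs_mul_abs hΔ
  have hp0 : ev Δ (rt Δ) p ≠ 0 := by
    intro h0; rw [h0, abs_zero, zero_mul] at h1; exact zero_ne_one h1
  refine ⟨hp0, fun q hq0 hlt => ?_⟩
  by_contra hcon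
  push Not at hcon
  have hqne : q ≠ (0, 0) := by rintro rfl; exact hq0 (by unfold ev; simp)
  have hN := Nm_ne_zero hΔ hqne
  have hN1 : (1 : ℝ) ≤ |(Nm Δ q : ℝ)| := by
    rw [← Int.cast_abs]; exact_mod_cast Int.one_le_abs hN
  rw [← ev_mul_ev_neg hΔ, abs_mul] at hN1
  have ha := abs_nonneg (ev Δ (rt Δ) q)
  have hb := abs_nonneg (ev Δ (-rt Δ) q)
  nlinarith [mul_lt_mul'' hlt hcon ha hb]

/-- Rational and irrational parts: `P + Q√Δ = 0` with `P, Q ∈ ℤ` forces `P = Q = 0`. [folklore] -/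
theorem int_add_int_mul_rt (hΔ : IsDisc Δ) {P Q : ℤ} (h : (P : ℝ) + Q * rt Δ = 0) : P = 0 ∧ Q = 0 := by
  by_cases hQ : Q = 0
  · subst hQ; simp at h; exact ⟨by exact_mod_cast h, rfl⟩
  · exfalso
    have hQ' : (Q : ℝ) ≠ 0 := by exact_mod_cast hQ
    have : rt Δ = ((-P : ℤ) : ℝ) / ((Q : ℤ) : ℝ) := by
      rw [eq_div_iff hQ']; push_cast; linarith
    exact (irrational_iff_ne_rational _).mp (irrational_rt hΔ) _ _ hQ this

variable {S : St}

/-- **In a frame, a unit `θ` forces `a = 1`**: `ψ = θ⁻¹ · θψ ∈ 𝒪` has `√Δ`-coordinate `1/2a`, which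
must be a half-integer (Jacobson–Williams §7.4: the unit ideal is the only ideal of norm `1` on the
cycle). [cite: JacobsonWilliams2008, §7.4] -/
theorem Inv.a_eq_one_of_isUnitO (hΔ : IsDisc Δ) (hI : Inv Δ S) (hu : IsUnitO Δ S.p) : S.a = 1 := by
  obtain ⟨q, hq⟩ := hu
  set w := omul Δ q S.r with hw
  have h1 : ev Δ (rt Δ) w = S.psi (rt Δ) := by
    rw [hw, ev_omul hΔ (rt_sq Δ), hI.ev_r (rt_sq Δ), ← mul_assoc, ← ev_omul hΔ (rt_sq Δ),
      omul_comm, hq, ev_one, one_mul]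
  unfold St.psi ev at h1
  have ha := hI.a_pos
  have h2 : ((2 * S.a * w.1 + S.a * w.2 * sig Δ - S.b : ℤ) : ℝ) + ((S.a * w.2 - 1 : ℤ) : ℝ) * rt Δ = 0 := by
    rw [eq_div_iff (by positivity)] at h1
    push_cast
    linear_combination h1
  obtain ⟨_, h3⟩ := int_add_int_mul_rt hΔ h2
  have ha1 : (1 : ℤ) ≤ S.a := by exact_mod_cast hI.1
  have : (S.a : ℤ) = 1 := by
    have h4 : (S.a : ℤ) * w.2 = 1 := by linarith
    rcases Int.eq_one_or_neg_one_of_mul_eq_one h4 with h | h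
    · exact h
    · linarith
  exact_mod_cast this

/-- In a frame, `b ≡ σ (mod 2)` when `a = 1` (`b² ≡ Δ (mod 4)`, and `b² ≡ b (mod 2)`). [folklore] -/
theorem Inv.two_dvd_b_sub_sig (hI : Inv Δ S) (ha : S.a = 1) : 2 ∣ S.b - sig Δ := by
  obtain ⟨k, hk⟩ := hI.2.1
  rw [ha] at hk
  push_cast at hk
  obtain ⟨j, hj⟩ := Int.even_mul_succ_self (S.b - 1)
  have e : S.b ^ 2 = j + j + S.b := by rw [← hj]; ring
  rw [e] at hk
  unfold sig
  push_cast
  omega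

/-- **In a frame with `a = 1`, `θ` is a unit**: `1 ∈ 𝒪 = θℤ + θψℤ` gives `θ⁻¹ = x + yψ ∈ 𝒪`
(`ψ = (b + √Δ)/2 = ω + (b - σ)/2`). [cite: JacobsonWilliams2008, §7.4] -/
theorem Inv.isUnitO_of_a_eq_one (hΔ : IsDisc Δ) (hI : Inv Δ S) (ha : S.a = 1) : IsUnitO Δ S.p := by
  obtain ⟨x, y, hxy⟩ := hI.2.2.2 (1, 0)
  obtain ⟨m, hm⟩ := hI.two_dvd_b_sub_sig ha
  -- the candidate inverse `x + y ψ = (x + y m) + y ω`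
  refine ⟨(x + y * m, y), ?_⟩
  apply ev_injective (irrational_rt hΔ)
  rw [ev_omul hΔ (rt_sq Δ), ev_one]
  have h1 : (1 : ℝ) = ev Δ (rt Δ) S.p * (x + y * S.psi (rt Δ)) := by
    rw [← hI.ev_of_spans (rt_sq Δ) hxy, ev_one]
  have hψ : S.psi (rt Δ) = ev Δ (rt Δ) (m, 1) := by
    unfold St.psi ev
    rw [ha]; push_cast
    have hm' : (S.b : ℝ) - sig Δ = 2 * m := by exact_mod_cast hm
    linear_combination (1 / 2 : ℝ) * hm'
  rw [h1, hψ]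
  unfold ev; push_cast; ring

/-! ### The walk `ρⁿ` -/

/-- `walk S n = ρⁿ(S)`. [cite: JacobsonWilliams2008, §5.3 (5.17)] -/
def walk (Δ : ℕ) (S : St) (n : ℕ) : St := (bstep Δ)^[n] S

/-- `walk S 0 = S`. [folklore] -/
@[simp] theorem walk_zero (S : St) : walk Δ S 0 = S := rfl

/-- `walk S (n+1) = ρ (walk S n)`. [folklore] -/
theorem walk_succ (S : St) (n : ℕ) : walk Δ S (n + 1) = bstep Δ (walk Δ S n) := by
  unfold walk; rw [Function.iterate_succ_apply']

/-- **Reduced frames stay reduced along the walk.** [cite: JacobsonWilliams2008, §5.3 (5.17)] -/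
theorem Inv.walk_spec (hΔ : IsDisc Δ) (hI : Inv Δ S) (hR : Red Δ S) (n : ℕ) :
    Inv Δ (walk Δ S n) ∧ Red Δ (walk Δ S n) := by
  induction n with
  | zero => exact ⟨hI, hR⟩
  | succ n ih => rw [walk_succ]; exact ⟨ih.1.bstep ih.2, ih.2.bstep hΔ ih.1⟩

/-- The distance `|θ_n|` along the walk. [cite: JacobsonWilliams2008, §7.4 (distance)] -/
def theta (Δ : ℕ) (S : St) (n : ℕ) : ℝ := |ev Δ (rt Δ) (walk Δ S n).p|

/-- `|θ|` increases strictly at each step. [cite: JacobsonWilliams2008, §5.1 (5.9)] -/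
theorem Inv.theta_lt_succ (hΔ : IsDisc Δ) (hI : Inv Δ S) (hR : Red Δ S) (n : ℕ) :
    theta Δ S n < theta Δ S (n + 1) := by
  obtain ⟨hIn, hRn⟩ := hI.walk_spec hΔ hR n
  unfold theta; rw [walk_succ, bstep_p]
  exact hIn.abs_p_lt_abs_r hΔ hRn

/-- `|θ|` is monotone along the walk. [folklore] -/
theorem Inv.theta_mono (hΔ : IsDisc Δ) (hI : Inv Δ S) (hR : Red Δ S) {i j : ℕ} (h : i ≤ j) :
    theta Δ S i ≤ theta Δ S j := by
  induction h with
  | refl => exact le_refl _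
  | step _ ih => exact ih.trans (hI.theta_lt_succ hΔ hR _).le

/-- `|θ|` is strictly monotone along the walk. [folklore] -/
theorem Inv.theta_strictMono (hΔ : IsDisc Δ) (hI : Inv Δ S) (hR : Red Δ S) {i j : ℕ} (h : i < j) :
    theta Δ S i < theta Δ S j :=
  (hI.theta_lt_succ hΔ hR i).trans_le (hI.theta_mono hΔ hR (Nat.succ_le_of_lt h))

/-- `θ₀ ≠ 0`, so all distances are positive. [folklore] -/
theorem Inv.theta_pos (hΔ : IsDisc Δ) (hI : Inv Δ S) (hR : Red Δ S) (n : ℕ) : 0 < theta Δ S n :=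
  abs_pos.mpr ((hI.walk_spec hΔ hR n).1.ev_p_ne_zero hΔ)

/-- **Two steps more than double the distance**: `2|θ_n| < |θ_{n+2}|` (Jacobson–Williams, proof of
Thm. 5.18). [cite: JacobsonWilliams2008, §5.3 Thm. 5.18 (proof)] -/
theorem Inv.two_mul_theta_lt (hΔ : IsDisc Δ) (hI : Inv Δ S) (hR : Red Δ S) (n : ℕ) :
    2 * theta Δ S n < theta Δ S (n + 2) := by
  obtain ⟨hIn, hRn⟩ := hI.walk_spec hΔ hR n
  obtain ⟨hI2, hR2⟩ := hI.walk_spec hΔ hR (n + 2)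
  have e : (walk Δ S (n + 1)).p = (walk Δ S n).r := by rw [walk_succ, bstep_p]
  have hlt : |ev Δ (rt Δ) (walk Δ S n).r| < |ev Δ (rt Δ) (walk Δ S (n + 2)).p| := by
    have h12 : theta Δ S (n + 1) < theta Δ S (n + 2) := hI.theta_lt_succ hΔ hR (n + 1)
    unfold theta at h12
    rwa [e] at h12
  exact hIn.two_mul_lt hΔ hRn (hI2.isMin_p hΔ hR2) hlt

/-- `2ᵏ |θ₀| ≤ |θ_{2k}|`. [cite: JacobsonWilliams2008, §5.3 Thm. 5.18 (proof)] -/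
theorem Inv.pow_mul_theta_le (hΔ : IsDisc Δ) (hI : Inv Δ S) (hR : Red Δ S) (k : ℕ) :
    2 ^ k * theta Δ S 0 ≤ theta Δ S (2 * k) := by
  induction k with
  | zero => simp
  | succ k ih =>
    have h := hI.two_mul_theta_lt hΔ hR (2 * k)
    have e : 2 * (k + 1) = 2 * k + 2 := by ring
    rw [e, pow_succ]
    nlinarith

/-- **A step grows the distance by less than `√Δ`**: `ψ = (b + √Δ)/2a < √Δ` (Jacobson–Williams
Cor. 5.8.1: `a < √Δ`, and `b < √Δ`). [cite: JacobsonWilliams2008, §5.1 Cor. 5.8.1] -/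
theorem Inv.theta_succ_lt (hΔ : IsDisc Δ) (hI : Inv Δ S) (hR : Red Δ S) (n : ℕ) :
    theta Δ S (n + 1) < theta Δ S n * rt Δ := by
  obtain ⟨hIn, hRn⟩ := hI.walk_spec hΔ hR n
  obtain ⟨hψ1, _, _⟩ := hRn.psi_bounds hIn.1
  have hθ := hI.theta_pos hΔ hR n
  unfold theta at hθ ⊢
  rw [walk_succ, bstep_p, hIn.ev_r (rt_sq Δ), abs_mul,
    abs_of_pos (show (0 : ℝ) < (walk Δ S n).psi (rt Δ) by linarith)]
  apply mul_lt_mul_of_pos_left _ hθ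
  -- `ψ < √Δ`
  have ha1 : (1 : ℝ) ≤ (walk Δ S n).a := by exact_mod_cast hIn.1
  have hs := rt_pos hΔ
  unfold St.psi
  rw [div_lt_iff₀ (by linarith)]
  nlinarith [hRn.2]

/-- **The walk reaches every minimum beyond `θ₀` exactly** (Jacobson–Williams Thm. 5.18), at the
first index where the distance is no longer below it, and within `2k` steps once `2ᵏ|θ₀| ≥ |μ|`.
[cite: JacobsonWilliams2008, §5.3 Thm. 5.18] -/
theorem Inv.exists_hit (hΔ : IsDisc Δ) (hI : Inv Δ S) (hR : Red Δ S) {u : ℤ × ℤ} (hu : IsMin Δ u)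
    (h0 : theta Δ S 0 < |ev Δ (rt Δ) u|) :
    ∃ N : ℕ, 1 ≤ N ∧ theta Δ S N = |ev Δ (rt Δ) u| ∧ (∀ i, i < N → theta Δ S i < |ev Δ (rt Δ) u|) ∧
      ∀ k : ℕ, |ev Δ (rt Δ) u| ≤ 2 ^ k * theta Δ S 0 → N ≤ 2 * k := by
  have hθ0 := hI.theta_pos hΔ hR 0
  -- the walk eventually passes `|u|`
  have hex : ∃ n, ¬ theta Δ S n < |ev Δ (rt Δ) u| := by
    obtain ⟨k, hk⟩ := pow_unbounded_of_one_lt (|ev Δ (rt Δ) u| / theta Δ S 0) (by norm_num : (1 : ℝ) < 2)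
    refine ⟨2 * k, not_lt.mpr ?_⟩
    have h1 := hI.pow_mul_theta_le hΔ hR k
    rw [div_lt_iff₀ hθ0] at hk
    linarith
  have hN := Nat.find_spec hex
  have hpos : 1 ≤ Nat.find hex := by
    by_contra h
    have h0' : Nat.find hex = 0 := by omega
    rw [h0'] at hN; exact hN h0
  refine ⟨Nat.find hex, hpos, ?_, fun i hi => ?_, fun k hk => ?_⟩
  · obtain ⟨M, hM⟩ : ∃ M, Nat.find hex = M + 1 := ⟨Nat.find hex - 1, by omega⟩
    have hprev : theta Δ S M < |ev Δ (rt Δ) u| := by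
      have := Nat.find_min hex (show M < Nat.find hex by omega)
      push Not at this; exact this
    obtain ⟨hIM, hRM⟩ := hI.walk_spec hΔ hR M
    have hle := hIM.next_le hΔ hRM hu hprev
    have hge := not_lt.mp hN
    rw [hM] at hge ⊢
    apply le_antisymm _ hge
    unfold theta; rw [walk_succ, bstep_p]; exact hle
  · have := Nat.find_min hex hi
    push Not at this; exact this
  · have h2 := hI.pow_mul_theta_le hΔ hR k
    exact Nat.find_min' hex (not_lt.mpr (by linarith))

/-- The negative of a unit is a unit. [folklore] -/
theorem IsUnitO.neg {p : ℤ × ℤ} (h : IsUnitO Δ p) : IsUnitO Δ (-p.1, -p.2) := by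
  obtain ⟨q, hq⟩ := h
  refine ⟨(-q.1, -q.2), ?_⟩
  rw [← hq]
  unfold omul; ext <;> simp only <;> ring

/-- **The first return to norm `1` is the next unit**: walking from a reduced frame, the first index
`N ≥ 1` with `a_N = 1` is where `θ_N = ±ε`, `ε` the least unit (in absolute value) beyond `|θ₀|`;
moreover `N ≤ 2k` as soon as `2ᵏ|θ₀| ≥ |ε|` (Jacobson–Williams §7.4: the principal cycle from `(1)`
back to `(1)` has length `R_Δ = log ε_Δ`). [cite: JacobsonWilliams2008, §7.4] -/
theorem Inv.first_unit (hΔ : IsDisc Δ) (hI : Inv Δ S) (hR : Red Δ S) {u : ℤ × ℤ} (hu : IsUnitO Δ u)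
    (h0 : theta Δ S 0 < |ev Δ (rt Δ) u|)
    (hleast : ∀ u' : ℤ × ℤ, IsUnitO Δ u' → theta Δ S 0 < |ev Δ (rt Δ) u'| →
      |ev Δ (rt Δ) u| ≤ |ev Δ (rt Δ) u'|) :
    ∃ N : ℕ, 1 ≤ N ∧ (walk Δ S N).a = 1 ∧ (∀ i, 1 ≤ i → i < N → (walk Δ S i).a ≠ 1) ∧
      (ev Δ (rt Δ) (walk Δ S N).p = ev Δ (rt Δ) u ∨ ev Δ (rt Δ) (walk Δ S N).p = -ev Δ (rt Δ) u) ∧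
      ∀ k : ℕ, |ev Δ (rt Δ) u| ≤ 2 ^ k * theta Δ S 0 → N ≤ 2 * k := by
  obtain ⟨N, hN1, hNeq, hbefore, hbound⟩ := hI.exists_hit hΔ hR (hu.isMin hΔ) h0
  obtain ⟨hIN, hRN⟩ := hI.walk_spec hΔ hR N
  have hsign : ev Δ (rt Δ) (walk Δ S N).p = ev Δ (rt Δ) u ∨
      ev Δ (rt Δ) (walk Δ S N).p = -ev Δ (rt Δ) u := abs_eq_abs.mp hNeq
  refine ⟨N, hN1, ?_, fun i hi1 hiN hai => ?_, hsign, hbound⟩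
  · -- `θ_N = ±u` is a unit, hence `a_N = 1`
    apply hIN.a_eq_one_of_isUnitO hΔ
    rcases hsign with h | h
    · rw [ev_injective (irrational_rt hΔ) h]; exact hu
    · rw [← ev_neg] at h
      rw [ev_injective (irrational_rt hΔ) h]; exact hu.neg
  · -- an earlier `a_i = 1` would be a unit strictly between `|θ₀|` and `|u|`
    obtain ⟨hIi, hRi⟩ := hI.walk_spec hΔ hR i
    have hui := hIi.isUnitO_of_a_eq_one hΔ hai
    have h0i : theta Δ S 0 < theta Δ S i := hI.theta_strictMono hΔ hR (by omega)
    have h1 := hleast _ hui h0i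
    have h2 := hbefore i hiN
    unfold theta at h1 h2 h0i
    linarith

end Literature.NumberTheory.QuadraticFields.Infra

end
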